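import Summits.FinalStateConjecture.FinalStateConjecture.Statement
import Literature.Geometry.Lorentzian.CausalityOpennessProofs
import Literature.Geometry.Lorentzian.CauchyDevelopmentAcausal

/-!
# Solo (blind) — the first-meeting lemma behind the localisation of the bag-of-gold analysis

In the localised analysis of candidate counterexamples to the typed final state conjecture
(`paper/bag-of-gold-note.md`, §B12) the only place where the far asymptotically flat region could
interact with the compact side of the data is a point where the causal futures `J⁺(A₁)`, `J⁺(A₂)`
of two disjoint pieces `A₁, A₂ ⊆ ι(X)` of the data hypersurface first meet. The elementary causal
fact recorded here (§B12.3, first step) is that such a FIRST meeting point — a point `q₀` of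
`J⁺(A₁) ∩ J⁺(A₂)` at which a function `s` that increases strictly along future causal curves
(e.g. a Cauchy temporal function) is minimal on `J⁺(A₁) ∩ J⁺(A₂)` — cannot lie in the
chronological future `I⁺(A₁)` unless it is a point of `A₂` itself (and symmetrically); for pieces
of the data hypersurface of a Cauchy development, which is acausal, it therefore lies on both
achronal boundaries `J⁺(Aᵢ) ∖ I⁺(Aᵢ)`.

* `soloBlind_exists_mem_causalFuture_lt` — if `q ∈ J⁺(A) ∖ A`, every neighbourhood of `q` contains
  points `p ∈ J⁺(A)` with `s p < s q`: the points of a causal curve from `A` to `q` shortly before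
  its endpoint.
* `soloBlind_firstMeeting_mem_of_mem_chronologicalFuture` — at an `s`-minimal point `q₀` of
  `J⁺(A₁) ∩ J⁺(A₂)`, `q₀ ∈ I⁺(A₁)` forces `q₀ ∈ A₂` (`I⁺(A₁)` is an open neighbourhood of `q₀`,
  O'Neill 1983, Lemma 14.3, and `I⁺ ⊆ J⁺`).
* `soloBlind_firstMeeting_not_mem_chronologicalFuture` — for a Cauchy development `𝒟` and disjoint
  `A₁, A₂ ⊆ ι(X)`, an `s`-minimal point of `J⁺(A₁) ∩ J⁺(A₂)` lies in neither `I⁺(A₁)` nor `I⁺(A₂)`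
  (acausality of the data hypersurface, O'Neill 1983, Lemma 14.42).

References: B. O'Neill, *Semi-Riemannian geometry*, Academic Press 1983, Ch. 14, pp. 402–403
(relations `≪`, `≤`; Lemma 14.3: `I⁺(S)` open), Lemma 14.42 (p. 425: a spacelike Cauchy
hypersurface is acausal).
-/

noncomputable section

open Literature.Geometry.Lorentzian Set Filter
open scoped Manifold ContDiff Topology

set_option linter.dupNamespace false

namespace Summit.FinalStateConjecture.FinalStateConjecture.Theorems

section Approach

variable {E : Type*} [NormedAddCommGroup E] [NormedSpace ℝ E] {H : Type*} [TopologicalSpace H]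
  {I : ModelWithCorners ℝ E H} {n : ℕ∞ω} {M : Type*} [TopologicalSpace M] [ChartedSpace H M]
  [IsManifold I ∞ M] {g : LorentzianMetric I n M} {τ : TimeOrientation g}

/-- **Approaching a point of `J⁺(A) ∖ A` from inside `J⁺(A)` with smaller time.** If `s` increases
strictly along future causal curves and `q ∈ J⁺(A)`, `q ∉ A`, then every neighbourhood of `q`
contains a point `p ∈ J⁺(A)` with `s p < s q` — a point of a causal curve from `A` to `q` shortly
before `q`. O'Neill 1983, Ch. 14, p. 402 (the relation `≤`). -/
theorem soloBlind_exists_mem_causalFuture_lt {A N : Set M} {q : M} {s : M → ℝ}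
    (hs : ∀ (γ : ℝ → M) (a b : ℝ), a < b → g.IsFutureCausalCurveOn τ γ (Icc a b) →
      s (γ a) < s (γ b))
    (hq : q ∈ g.causalFuture τ A) (hqA : q ∉ A) (hN : N ∈ 𝓝 q) :
    ∃ p ∈ N, p ∈ g.causalFuture τ A ∧ s p < s q := by
  rcases hq with hq | ⟨p₀, hp₀, γ, a, b, hab, hγ, hγa, hγb⟩
  · exact (hqA hq).elim
  have hcont : ContinuousWithinAt γ (Icc a b) b :=
    (hγ b (right_mem_Icc.2 hab.le)).1.continuousAt.continuousWithinAt
  have hN' : ∀ᶠ t in 𝓝[Icc a b] b, γ t ∈ N := hcont (by rw [hγb]; exact hN)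
  haveI : (𝓝[Ioo a b] b).NeBot := by
    refine mem_closure_iff_nhdsWithin_neBot.1 ?_
    rw [closure_Ioo hab.ne]
    exact right_mem_Icc.2 hab.le
  obtain ⟨t, htN, hat, htb⟩ :=
    ((hN'.filter_mono (nhdsWithin_mono b Ioo_subset_Icc_self)).and self_mem_nhdsWithin).exists
  refine ⟨γ t, htN, Or.inr ⟨p₀, hp₀, γ, a, t, hat, hγ.mono (Icc_subset_Icc_right htb.le), hγa,
    rfl⟩, ?_⟩
  rw [← hγb]
  exact hs γ t b htb (hγ.mono (Icc_subset_Icc_left hat.le))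

end Approach

section FirstMeeting

variable {E : Type*} [NormedAddCommGroup E] [NormedSpace ℝ E] {H : Type*} [TopologicalSpace H]
  {I : ModelWithCorners ℝ E H} {n : ℕ∞ω} {M : Type*} [TopologicalSpace M] [ChartedSpace H M]
  [IsManifold I ∞ M] [BoundarylessManifold I M] {g : LorentzianMetric I n M}
  {τ : TimeOrientation g}

/-- **First-meeting lemma (abstract form).** Let `s` increase strictly along future causal curves
and let `q₀ ∈ J⁺(A₂)` minimise `s` on `J⁺(A₁) ∩ J⁺(A₂)`. If `q₀ ∈ I⁺(A₁)` then `q₀ ∈ A₂`: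
otherwise `I⁺(A₁)` is an open neighbourhood of `q₀` (O'Neill 1983, Lemma 14.3) and contains
points of `J⁺(A₂)` with smaller `s` (`soloBlind_exists_mem_causalFuture_lt`), which lie in
`J⁺(A₁) ∩ J⁺(A₂)` because `I⁺(A₁) ⊆ J⁺(A₁)` — contradicting minimality. -/
theorem soloBlind_firstMeeting_mem_of_mem_chronologicalFuture {A₁ A₂ : Set M} {s : M → ℝ}
    (hs : ∀ (γ : ℝ → M) (a b : ℝ), a < b → g.IsFutureCausalCurveOn τ γ (Icc a b) →
      s (γ a) < s (γ b))
    {q₀ : M} (h₂ : q₀ ∈ g.causalFuture τ A₂)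
    (hmin : ∀ p ∈ g.causalFuture τ A₁ ∩ g.causalFuture τ A₂, s q₀ ≤ s p)
    (h₁ : q₀ ∈ g.chronologicalFuture τ A₁) : q₀ ∈ A₂ := by
  by_contra hqA
  obtain ⟨p, hpN, hpJ, hps⟩ := soloBlind_exists_mem_causalFuture_lt hs h₂ hqA
    ((LorentzianMetric.isOpen_chronologicalFuture_of_boundaryless g τ A₁).mem_nhds h₁)
  exact not_lt.2 (hmin p ⟨LorentzianMetric.chronologicalFuture_subset_causalFuture g τ A₁ hpN, hpJ⟩)
    hps

/-- Symmetric packaging: an `s`-minimal point of `J⁺(A₁) ∩ J⁺(A₂)` lies in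
`(J⁺(A₁) ∖ I⁺(A₁)) ∪ A₂` and in `(J⁺(A₂) ∖ I⁺(A₂)) ∪ A₁`. O'Neill 1983, Ch. 14, Lemma 14.3. -/
theorem soloBlind_firstMeeting_boundary_or_mem {A₁ A₂ : Set M} {s : M → ℝ}
    (hs : ∀ (γ : ℝ → M) (a b : ℝ), a < b → g.IsFutureCausalCurveOn τ γ (Icc a b) →
      s (γ a) < s (γ b))
    {q₀ : M} (hq₀ : q₀ ∈ g.causalFuture τ A₁ ∩ g.causalFuture τ A₂)
    (hmin : ∀ p ∈ g.causalFuture τ A₁ ∩ g.causalFuture τ A₂, s q₀ ≤ s p) :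
    (q₀ ∉ g.chronologicalFuture τ A₁ ∨ q₀ ∈ A₂) ∧ (q₀ ∉ g.chronologicalFuture τ A₂ ∨ q₀ ∈ A₁) := by
  refine ⟨or_iff_not_imp_left.2 fun h ↦ ?_, or_iff_not_imp_left.2 fun h ↦ ?_⟩
  · exact soloBlind_firstMeeting_mem_of_mem_chronologicalFuture hs hq₀.2 hmin (not_not.1 h)
  · refine soloBlind_firstMeeting_mem_of_mem_chronologicalFuture hs hq₀.1 (fun p hp ↦ ?_)
      (not_not.1 h)
    exact hmin p ⟨hp.2, hp.1⟩

end FirstMeeting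

section Development

variable {X : Type} [TopologicalSpace X] [ChartedSpace E3 X] [IsManifold (𝓡 3) ∞ X]
  [ConnectedSpace X] {D : InitialDataSet (𝓡 3) X}

/-- **First-meeting lemma for pieces of the data hypersurface of a Cauchy development.** Let `𝒟` be
a Cauchy development of `D`, `A₁, A₂ ⊆ ι(X)` disjoint, `s` a function on `𝒟` increasing strictly
along future causal curves (e.g. a Cauchy temporal function), and `q₀` an `s`-minimal point of
`J⁺(A₁) ∩ J⁺(A₂)`. Then `q₀ ∉ I⁺(A₁)` and `q₀ ∉ I⁺(A₂)`: the two causal futures first meet on both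
achronal boundaries. (By `soloBlind_firstMeeting_boundary_or_mem`, `q₀ ∈ I⁺(A₁)` would force
`q₀ ∈ A₂ ⊆ ι(X)`; but `I⁺(A₁) ⊆ J⁺(A₁)` and the data hypersurface is acausal — O'Neill 1983,
Lemma 14.42 — so `q₀ ∈ A₁`, contradicting disjointness.) This is the first step of §B12.3 of
`paper/bag-of-gold-note.md`: the separation hypothesis (Sep) of the localised analysis can only
fail at a point lying on BOTH Cauchy-horizon pieces of the development of the middle data. -/
theorem soloBlind_firstMeeting_not_mem_chronologicalFuture (𝒟 : CauchyDevelopment D)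
    {A₁ A₂ : Set 𝒟.carrier} (hA₁ : A₁ ⊆ range 𝒟.embed) (hA₂ : A₂ ⊆ range 𝒟.embed)
    (hdisj : Disjoint A₁ A₂) {s : 𝒟.carrier → ℝ}
    (hs : ∀ (γ : ℝ → 𝒟.carrier) (a b : ℝ), a < b →
      𝒟.metric.IsFutureCausalCurveOn 𝒟.timeOrientation γ (Icc a b) → s (γ a) < s (γ b))
    {q₀ : 𝒟.carrier}
    (hq₀ : q₀ ∈ 𝒟.metric.causalFuture 𝒟.timeOrientation A₁ ∩
      𝒟.metric.causalFuture 𝒟.timeOrientation A₂)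
    (hmin : ∀ p ∈ 𝒟.metric.causalFuture 𝒟.timeOrientation A₁ ∩
      𝒟.metric.causalFuture 𝒟.timeOrientation A₂, s q₀ ≤ s p) :
    q₀ ∉ 𝒟.metric.chronologicalFuture 𝒟.timeOrientation A₁ ∧
      q₀ ∉ 𝒟.metric.chronologicalFuture 𝒟.timeOrientation A₂ := by
  -- a point of `ι(X)` in `J⁺(Aᵢ)` is a point of `Aᵢ` (acausality of the data hypersurface)
  have key : ∀ {A B : Set 𝒟.carrier}, A ⊆ range 𝒟.embed → B ⊆ range 𝒟.embed → Disjoint A B →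
      ∀ {q : 𝒟.carrier}, q ∈ 𝒟.metric.chronologicalFuture 𝒟.timeOrientation A → q ∈ B →
        False := by
    intro A B hA hB hAB q hqI hqB
    have hqJ := LorentzianMetric.chronologicalFuture_subset_causalFuture 𝒟.metric
      𝒟.timeOrientation A hqI
    rw [LorentzianMetric.causalFuture_eq_biUnion] at hqJ
    simp only [mem_iUnion, exists_prop] at hqJ
    obtain ⟨p, hpA, hqp⟩ := hqJ
    have hpq : q = p := 𝒟.eq_of_mem_causalFuture_range_embed p (hA hpA) q (hB hqB) hqp
    exact hAB.le_bot ⟨hpq ▸ hpA, hqB⟩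
  obtain ⟨h₁, h₂⟩ := soloBlind_firstMeeting_boundary_or_mem hs hq₀ hmin
  exact ⟨fun h ↦ key hA₁ hA₂ hdisj h (h₁.resolve_left (not_not.2 h)),
    fun h ↦ key hA₂ hA₁ hdisj.symm h (h₂.resolve_left (not_not.2 h))⟩

end Development

end Summit.FinalStateConjecture.FinalStateConjecture.Theorems
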